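import Summits.HodgeConjecture.HodgeCM.Model.AdelicThetaDistributionBridge_1

/-! PORT of `HodgeCM/Model/AdelicThetaDistributionBridge.lean` (HodgeCMPerL run 82) — part 2: continuation of `Summits.HodgeConjecture.HodgeCM.Model.AdelicThetaDistributionBridge_1` (split at a top-level declaration boundary by port_pkg.py; scope re-opened below; declarations unchanged). -/

-- port_pkg: scope re-opened for this part (file-level context, then the namespace/section stack open at the cut)
set_option autoImplicit false
noncomputable section
open MulAction IsDedekindDomain NumberField.mixedEmbedding
open NumberField hiding relNormOneIdeles relNormOneRat probHaarRelNormOneQuot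
open scoped Matrix TensorProduct Classical SchwartzMap
open Literature.NumberTheory.Automorphic Literature.NumberTheory.Weil1964
open Literature.NumberTheory.GelbartRogawski1991 Literature.NumberTheory.GelbartRogawski1991.UnitaryDualPair
open Literature.RepresentationTheory (SeesawScalar.twist SeesawScalar.twist_apply)
open Literature.Geometry.ComplexHyperbolic.BallModel (U21 x₀)
open Literature.AlgebraicGeometry.ShimuraVarieties
open HodgeCM.Adelic HodgeCM.PerL34 HodgeCM.Model.ArchSideTerm HodgeCM.Model.ThetaDistFin
namespace HodgeCM.Model
namespace ThetaAdelicSide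
variable {L : CMField} {ι₁ : L →+* ℂ} (V : HermSpace3 L ι₁) (c : SeesawCtx L)
  (hGR : (cmSplittingDatum (L : Type) finProdFinEquiv (frameD V) (frameD_real V) (frameD_ne V) (dW c.D) (dW_real c.D)
    (dW_ne c.D)).CompatibleSplitting)
  (hGR₀ : (cmSplittingDatum (L : Type) (e₁) (frameD V) (frameD_real V) (frameD_ne V) (lineVec (L : Type) (dW c.D 0))
    (fun _ => dW_real c.D 0) (fun _ => dW_ne c.D 0)).CompatibleSplitting)
  (hGR₁ : (cmSplittingDatum (L : Type) (e₁) (frameD V) (frameD_real V) (frameD_ne V) (lineVec (L : Type) (dW c.D 1))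
    (fun _ => dW_real c.D 1) (fun _ => dW_ne c.D 1)).CompatibleSplitting)
  (hGR₂ : (cmSplittingDatum (L : Type) (e₁) (frameD V) (frameD_real V) (frameD_ne V) (lineVec (L : Type) (dW' c.D 0))
    (fun _ => dW'_real c.D 0) (fun _ => dW'_ne c.D 0)).CompatibleSplitting)
  (hGR₃ : (cmSplittingDatum (L : Type) (e₁) (frameD V) (frameD_real V) (frameD_ne V) (lineVec (L : Type) (dW' c.D 1))
    (fun _ => dW'_real c.D 1) (fun _ => dW'_ne c.D 1)).CompatibleSplitting)
  (η : CMAdelic (L : Type) (frameD V) × CMAdelic (L : Type) (dW c.D) →* ℂˣ)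
  (hη : ∀ γU ∈ CMRat (L : Type) (frameD V), ∀ γ ∈ CMRat (L : Type) (dW c.D), η (γU, γ) = 1)
  (hηc : Continuous fun p => ((η p : ℂˣ) : ℂ))
  (h₁W : (∀ j, 0 < (ι₁ (dW c.D j)).re) ∨ ∀ j, (ι₁ (dW c.D j)).re < 0)
  (A : ∀ k : Fin 4, ArchLineInput V (lineRepD V c.D hGR hGR₀ hGR₁ hGR₂ hGR₃ η k))
  (hV : IsAnisotropic L V.Hm)
/-- **`c_{W,1} : u ↦ finCharOne (1, u)`** — its `U(⟨a₁⟩)(𝔸_f)`-part. -/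
def cWOne : UfOne c.D →* ℂˣ :=
  (finCharOne V c.D hGR hGR₀ hGR₁ (eta₁ V c.D η)).comp (MonoidHom.inr _ _)

/-- (Ported verbatim from the HodgeCMPerL package; no docstring in the source.) -/
@[simp] theorem cVOne_apply (g : ↥V.adelicFin) :
    cVOne V c hGR hGR₀ hGR₁ η g = finCharOne V c.D hGR hGR₀ hGR₁ (eta₁ V c.D η) (g, 1) := rfl

/-- (Ported verbatim from the HodgeCMPerL package; no docstring in the source.) -/
@[simp] theorem cWOne_apply (u : UfOne c.D) :
    cWOne V c hGR hGR₀ hGR₁ η u = finCharOne V c.D hGR hGR₀ hGR₁ (eta₁ V c.D η) (1, u) := rfl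

/-- **`χ ↦ chiOne χ : u ↦ χ(finLineTorusIdeles u)⁻¹`** — the coinvariant character of slot 1 (the `chiFin` of every slot-1 datum
`thetaDistDatumOneOf …`, definitionally: `chiFin_thetaDistDatumOneOf`). -/
def chiOne (χ : PontryaginDual (↥(relNormOneIdeles (↥(maximalRealSubfield L)) L) ⧸ relNormOneRat (↥(maximalRealSubfield L)) L)) :
    UfOne c.D →* ℂˣ :=
  (Circle.toUnits : Circle →* ℂˣ).comp <| (invMonoidHom : Circle →* Circle).comp <|
    (χ : ↥(relNormOneIdeles (↥(maximalRealSubfield L)) L) ⧸ relNormOneRat (↥(maximalRealSubfield L)) L →* Circle).comp <|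
      (QuotientGroup.mk' (relNormOneRat (↥(maximalRealSubfield L)) L)).comp
        (finLineTorusIdeles (L : Type) (dW c.D 1) (dW_ne c.D 1))

/-- **the canonical dictionary-side character `ψ₁(χ) := chiOne χ · c_{W,1}⁻¹`**. -/
def psiOne (χ : PontryaginDual (↥(relNormOneIdeles (↥(maximalRealSubfield L)) L) ⧸ relNormOneRat (↥(maximalRealSubfield L)) L)) :
    UfOne c.D →* ℂˣ :=
  chiOne c χ * (cWOne V c hGR hGR₀ hGR₁ η)⁻¹

/-- `chiOne χ = c_{W,1} · ψ₁(χ)` pointwise (the hypothesis `hψ` below, for `ψ := psiOne χ`). -/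
theorem chiOne_eq_mul_psiOne
    (χ : PontryaginDual (↥(relNormOneIdeles (↥(maximalRealSubfield L)) L) ⧸ relNormOneRat (↥(maximalRealSubfield L)) L))
    (u : UfOne c.D) :
    chiOne c χ u = finCharOne V c.D hGR hGR₀ hGR₁ (eta₁ V c.D η) (1, u) * psiOne V c hGR hGR₀ hGR₁ η χ u := by
  rw [psiOne, MonoidHom.mul_apply, MonoidHom.inv_apply, cWOne_apply, mul_comm (chiOne c χ u), ← mul_assoc, mul_inv_cancel,
    one_mul]

/-- `chiFin` of every slot-1 datum IS `chiOne` (definitional: `toIdele := finLineTorusIdeles …`). -/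
theorem chiFin_thetaDistDatumOneOf
    (Φarch : Module.Dual ℂ (Fin 2 → ℂ) →ₗ[ℂ] 𝓢((Fin 3 → mixedSpace (↥(maximalRealSubfield L))), ℂ))
    (harm : ∀ (u : ↥(stabilizer U21 x₀)) (ℓ : Module.Dual ℂ (Fin 2 → ℂ)),
      lineOmega_one V c.D hGR hGR₀ hGR₁ (eta₁ V c.D η) (u : U21) (Φarch ℓ) =
        Φarch ((BallForms.isPullbackCocycle_cotangentCocycle.weightOf x₀).dual u ℓ))
    (hdef : ∀ a : UnitaryGroup.arch (↥(maximalRealSubfield L)) L (IsCMField.complexConj L) 3 V.Hm,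
      UnitaryGroup.archAt (↥(maximalRealSubfield L)) L (IsCMField.complexConj L) 3 V.Hm (UnitaryGroup.cmPlace (L : Type) ι₁)
          (NumberField.complexConj_smul_infinitePlace (L : Type) _) (IsCMField.complexConj_ne_one (L : Type)) a = 1 →
      ∀ (ℓ : Module.Dual ℂ (Fin 2 → ℂ)) (Φf : FinSB (↥(maximalRealSubfield L)) (Fin 3)),
        lineRepOf V c.D hGR hGR₀ hGR₁ hGR₂ hGR₃ (eta₀ V c.D η) (eta₁ V c.D η) (eta₂ V c.D η) (eta₃ V c.D η) 1
            (HodgeCM.Adelic.regimeEquiv L V.Hm hV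
              (UnitaryGroup.archToAdelic (↥(maximalRealSubfield L)) L (IsCMField.complexConj L) 3 V.Hm a), 1)
            (piSchwartzBruhatEquiv (↥(maximalRealSubfield L)) (Fin 3) (Φarch ℓ ⊗ₜ[ℂ] Φf)) =
          piSchwartzBruhatEquiv (↥(maximalRealSubfield L)) (Fin 3) (Φarch ℓ ⊗ₜ[ℂ] Φf))
    (χ : PontryaginDual (↥(relNormOneIdeles (↥(maximalRealSubfield L)) L) ⧸ relNormOneRat (↥(maximalRealSubfield L)) L)) :
    (thetaDistDatumOneOf V c hGR hGR₀ hGR₁ hGR₂ hGR₃ η hη hηc h₁W A hV Φarch harm hdef).chiFin χ = chiOne c χ := rfl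

/-! ### § 3b. The coinvariant comparison of slot 1 -/

section One

variable (Φarch : Module.Dual ℂ (Fin 2 → ℂ) →ₗ[ℂ] 𝓢((Fin 3 → mixedSpace (↥(maximalRealSubfield L))), ℂ))
  (harm : ∀ (u : ↥(stabilizer U21 x₀)) (ℓ : Module.Dual ℂ (Fin 2 → ℂ)),
    lineOmega_one V c.D hGR hGR₀ hGR₁ (eta₁ V c.D η) (u : U21) (Φarch ℓ) =
      Φarch ((BallForms.isPullbackCocycle_cotangentCocycle.weightOf x₀).dual u ℓ))
  (hdef : ∀ a : UnitaryGroup.arch (↥(maximalRealSubfield L)) L (IsCMField.complexConj L) 3 V.Hm,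
    UnitaryGroup.archAt (↥(maximalRealSubfield L)) L (IsCMField.complexConj L) 3 V.Hm (UnitaryGroup.cmPlace (L : Type) ι₁)
        (NumberField.complexConj_smul_infinitePlace (L : Type) _) (IsCMField.complexConj_ne_one (L : Type)) a = 1 →
    ∀ (ℓ : Module.Dual ℂ (Fin 2 → ℂ)) (Φf : FinSB (↥(maximalRealSubfield L)) (Fin 3)),
      lineRepOf V c.D hGR hGR₀ hGR₁ hGR₂ hGR₃ (eta₀ V c.D η) (eta₁ V c.D η) (eta₂ V c.D η) (eta₃ V c.D η) 1
          (HodgeCM.Adelic.regimeEquiv L V.Hm hV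
            (UnitaryGroup.archToAdelic (↥(maximalRealSubfield L)) L (IsCMField.complexConj L) 3 V.Hm a), 1)
          (piSchwartzBruhatEquiv (↥(maximalRealSubfield L)) (Fin 3) (Φarch ℓ ⊗ₜ[ℂ] Φf)) =
        piSchwartzBruhatEquiv (↥(maximalRealSubfield L)) (Fin 3) (Φarch ℓ ⊗ₜ[ℂ] Φf))
  (χ : PontryaginDual (↥(relNormOneIdeles (↥(maximalRealSubfield L)) L) ⧸ relNormOneRat (↥(maximalRealSubfield L)) L))
  (ψ : UfOne c.D →* ℂˣ)
  (hψ : ∀ u : UfOne c.D, chiOne c χ u = finCharOne V c.D hGR hGR₀ hGR₁ (eta₁ V c.D η) (1, u) * ψ u)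

/-- (T-W) the `U(⟨a₁⟩)(𝔸_f)`-member of the slot's finite factor on reindexed vectors:
`ω_{f,W}(u) (R f) = finCharOne(1, u) • R (finPairRepW splitLineOne.hs u f)`. -/
theorem ωfW_thetaDistDatumOneOf_finSBReindex (u : UfOne c.D) (f : FinSB (↥(maximalRealSubfield L)) (Fin 3 × Fin 1)) :
    (thetaDistDatumOneOf V c hGR hGR₀ hGR₁ hGR₂ hGR₃ η hη hηc h₁W A hV Φarch harm hdef).ωfW u
        (finSBReindex (↥(maximalRealSubfield L)) e₁ f) =
      ((finCharOne V c.D hGR hGR₀ hGR₁ (eta₁ V c.D η) (1, u) : ℂˣ) : ℂ) •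
        finSBReindex (↥(maximalRealSubfield L)) e₁
          (HodgeCM.WeilCoinv.finPairRepW _ _ _ _ _ _ _ _ _ _ _ _ _ _ _ _ _ (splitLineOne V c hGR₁).hs u f) := by
  show finRepOne V c.D hGR hGR₀ hGR₁ (eta₁ V c.D η) (1, u) _ = _
  rw [finRepOne_apply, map_one, LinearEquiv.symm_apply_apply]
  rfl

/-- (T-V) the `U(V)(𝔸_f)`-member: `ω_{f,V}(g) (R f) = finCharOne(g, 1) • R (finPairRepV splitLineOne.hs (finFrameCongr g) f)`. -/
theorem ωfV_thetaDistDatumOneOf_finSBReindex (g : ↥V.adelicFin) (f : FinSB (↥(maximalRealSubfield L)) (Fin 3 × Fin 1)) :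
    (thetaDistDatumOneOf V c hGR hGR₀ hGR₁ hGR₂ hGR₃ η hη hηc h₁W A hV Φarch harm hdef).ωfV g
        (finSBReindex (↥(maximalRealSubfield L)) e₁ f) =
      ((finCharOne V c.D hGR hGR₀ hGR₁ (eta₁ V c.D η) (g, 1) : ℂˣ) : ℂ) •
        finSBReindex (↥(maximalRealSubfield L)) e₁
          (HodgeCM.WeilCoinv.finPairRepV _ _ _ _ _ _ _ _ _ _ _ _ _ _ _ _ _ (splitLineOne V c hGR₁).hs
            (finFrameCongr (L : Type) V.Hm (frameG V) (frameD V) (frame_congr V) g) f) := by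
  show finRepOne V c.D hGR hGR₀ hGR₁ (eta₁ V c.D η) (g, 1) _ = _
  rw [finRepOne_apply, LinearEquiv.symm_apply_apply]
  rfl

/-- **THE COINVARIANT COMPARISON OF SLOT 1**: for every character `ψ` of `U(⟨a₁⟩)(𝔸_f)` with `chiOne χ = finCharOne(1, ·) · ψ`,
`Coinv (finPairRepW splitLineOne.hs) ψ ≃ₗ[ℂ] Coinv ω_{f,W} (chiFin χ)` — the carrier of the dictionary module `Ω(splitLineOne, ψ)` and
the carrier of the honest slot module `Ω₁(χ)`; theta-3's `TwistedCoinv.mapEquiv` along the reindexing `finSBReindex e₁` with the unit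
family `finCharOne(1, ·)` (`mk f ↦ mk (R f)`). -/
def coinvEquivOne :
    TwistedCoinv.Coinv (HodgeCM.WeilCoinv.finPairRepW _ _ _ _ _ _ _ _ _ _ _ _ _ _ _ _ _ (splitLineOne V c hGR₁).hs) ψ ≃ₗ[ℂ]
      TwistedCoinv.Coinv (thetaDistDatumOneOf V c hGR hGR₀ hGR₁ hGR₂ hGR₃ η hη hηc h₁W A hV Φarch harm hdef).ωfW
        ((thetaDistDatumOneOf V c hGR hGR₀ hGR₁ hGR₂ hGR₃ η hη hηc h₁W A hV Φarch harm hdef).chiFin χ) :=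
  TwistedCoinv.mapEquiv _ ψ _ _ (finSBReindex (↥(maximalRealSubfield L)) e₁)
    (fun u => finCharOne V c.D hGR hGR₀ hGR₁ (eta₁ V c.D η) (1, u))
    (fun u f => ωfW_thetaDistDatumOneOf_finSBReindex V c hGR hGR₀ hGR₁ hGR₂ hGR₃ η hη hηc h₁W A hV Φarch harm hdef u f) hψ

/-- `coinvEquivOne (mk f) = mk (R f)`. -/
@[simp] theorem coinvEquivOne_mk (f : FinSB (↥(maximalRealSubfield L)) (Fin 3 × Fin 1)) :
    coinvEquivOne V c hGR hGR₀ hGR₁ hGR₂ hGR₃ η hη hηc h₁W A hV Φarch harm hdef χ ψ hψ (TwistedCoinv.mk _ ψ f) =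
      TwistedCoinv.mk _ _ (finSBReindex (↥(maximalRealSubfield L)) e₁ f) := rfl

/-- **THE INTERTWINING LAW**: `Ω₁(χ)(g) (E x) = finCharOne(g, 1) • E (Ω(splitLineOne, ψ)(finFrameCongr g) x)` — the honest slot
module is the pullback along `finFrameCongr` of the dictionary module `Ω(splitLineOne, ψ) = weilCoinv … ψ splitLineOne.hs`, TWISTED
by `c_{V,1}`. [cite: GelbartRogawski1991, §3.1 Remark p. 457 L4–13] -/
theorem coinvRep_coinvEquivOne (g : ↥V.adelicFin)
    (x : TwistedCoinv.Coinv (HodgeCM.WeilCoinv.finPairRepW _ _ _ _ _ _ _ _ _ _ _ _ _ _ _ _ _ (splitLineOne V c hGR₁).hs) ψ) :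
    (thetaDistDatumOneOf V c hGR hGR₀ hGR₁ hGR₂ hGR₃ η hη hηc h₁W A hV Φarch harm hdef).coinvRep χ g
        (coinvEquivOne V c hGR hGR₀ hGR₁ hGR₂ hGR₃ η hη hηc h₁W A hV Φarch harm hdef χ ψ hψ x) =
      ((finCharOne V c.D hGR hGR₀ hGR₁ (eta₁ V c.D η) (g, 1) : ℂˣ) : ℂ) •
        coinvEquivOne V c hGR hGR₀ hGR₁ hGR₂ hGR₃ η hη hηc h₁W A hV Φarch harm hdef χ ψ hψ
          (HodgeCM.WeilCoinv.weilCoinv _ _ _ _ _ _ _ _ _ _ _ _ _ _ _ _ _ ψ (splitLineOne V c hGR₁).hs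
            (finFrameCongr (L : Type) V.Hm (frameG V) (frameD V) (frame_congr V) g) x) :=
  TwistedCoinv.mapEquiv_rep _ ψ _ _
    (HodgeCM.WeilCoinv.finPairRepV _ _ _ _ _ _ _ _ _ _ _ _ _ _ _ _ _ (splitLineOne V c hGR₁).hs) _
    (HodgeCM.WeilCoinv.commute_finPairRepV_finPairRepW _ _ _ _ _ _ _ _ _ _ _ _ _ _ _ _ _ (splitLineOne V c hGR₁).hs)
    (thetaDistDatumOneOf V c hGR hGR₀ hGR₁ hGR₂ hGR₃ η hη hηc h₁W A hV Φarch harm hdef).commute_ωfV_ωfW _ _ _ hψ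
    (fun f => ωfV_thetaDistDatumOneOf_finSBReindex V c hGR hGR₀ hGR₁ hGR₂ hGR₃ η hη hηc h₁W A hV Φarch harm hdef g f) x

/-- the same law against the `c_{V,1}`-TWISTED PULLBACK `SeesawScalar.twist cVOne (Ω(splitLineOne, ψ) ∘ finFrameCongr)`:
`E ∘ (twist …)(g) = Ω₁(χ)(g) ∘ E`. -/
theorem coinvEquivOne_twist (g : ↥V.adelicFin)
    (x : TwistedCoinv.Coinv (HodgeCM.WeilCoinv.finPairRepW _ _ _ _ _ _ _ _ _ _ _ _ _ _ _ _ _ (splitLineOne V c hGR₁).hs) ψ) :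
    coinvEquivOne V c hGR hGR₀ hGR₁ hGR₂ hGR₃ η hη hηc h₁W A hV Φarch harm hdef χ ψ hψ
        (SeesawScalar.twist (cVOne V c hGR hGR₀ hGR₁ η)
          ((HodgeCM.WeilCoinv.weilCoinv _ _ _ _ _ _ _ _ _ _ _ _ _ _ _ _ _ ψ (splitLineOne V c hGR₁).hs).comp
            (finFrameCongr (L : Type) V.Hm (frameG V) (frameD V) (frame_congr V))) g x) =
      (thetaDistDatumOneOf V c hGR hGR₀ hGR₁ hGR₂ hGR₃ η hη hηc h₁W A hV Φarch harm hdef).coinvRep χ g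
        (coinvEquivOne V c hGR hGR₀ hGR₁ hGR₂ hGR₃ η hη hηc h₁W A hV Φarch harm hdef χ ψ hψ x) := by
  rw [SeesawScalar.twist_apply, coinvRep_coinvEquivOne]
  exact map_smul (coinvEquivOne V c hGR hGR₀ hGR₁ hGR₂ hGR₃ η hη hηc h₁W A hV Φarch harm hdef χ ψ hψ) _ _

include hψ in
/-- **THE BRIDGE OF SLOT 1, module currency**: the `c_{V,1}`-twisted pullback of the dictionary carrier `Ω(splitLineOne, ψ)` IS the
honest slot module `Ω₁(χ)`, as `ℂ[U(V)(𝔸_f)]`-modules. -/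
def ΩEquivOne :
    (SeesawScalar.twist (cVOne V c hGR hGR₀ hGR₁ η)
          ((HodgeCM.WeilCoinv.weilCoinv _ _ _ _ _ _ _ _ _ _ _ _ _ _ _ _ _ ψ (splitLineOne V c hGR₁).hs).comp
            (finFrameCongr (L : Type) V.Hm (frameG V) (frameD V) (frame_congr V)))).asModule ≃ₗ[adelicAlgebra V]
      ((thetaDistDatumOneOf V c hGR hGR₀ hGR₁ hGR₂ hGR₃ η hη hηc h₁W A hV Φarch harm hdef).coinvRep χ).asModule :=
  EquivariantLift.liftEquiv _ _ (coinvEquivOne V c hGR hGR₀ hGR₁ hGR₂ hGR₃ η hη hηc h₁W A hV Φarch harm hdef χ ψ hψ)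
    (coinvEquivOne_twist V c hGR hGR₀ hGR₁ hGR₂ hGR₃ η hη hηc h₁W A hV Φarch harm hdef χ ψ hψ)

include hψ in
/-- **BLOCKS EQUAL (slot 1)**: for every `ℂ[U(V)(𝔸_f)]`-module `T` (the tower),
`⨆ ψ′ : Ω₁(χ) →ₗ T, (range ψ′)|_ℂ = ⨆ ψ′ : (twist c_{V,1} (Ω(splitLineOne, ψ) ∘ finFrameCongr)).asModule →ₗ T, (range ψ′)|_ℂ`. -/
theorem iSup_range_coinvRep_one_eq {T : Type*} [AddCommMonoid T] [Module ℂ T] [Module (adelicAlgebra V) T]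
    [IsScalarTower ℂ (adelicAlgebra V) T] :
    (⨆ f : ((thetaDistDatumOneOf V c hGR hGR₀ hGR₁ hGR₂ hGR₃ η hη hηc h₁W A hV Φarch harm hdef).coinvRep χ).asModule
        →ₗ[adelicAlgebra V] T, (LinearMap.range f).restrictScalars ℂ) =
      ⨆ f : (SeesawScalar.twist (cVOne V c hGR hGR₀ hGR₁ η)
          ((HodgeCM.WeilCoinv.weilCoinv _ _ _ _ _ _ _ _ _ _ _ _ _ _ _ _ _ ψ (splitLineOne V c hGR₁).hs).comp
            (finFrameCongr (L : Type) V.Hm (frameG V) (frameD V) (frame_congr V)))).asModule →ₗ[adelicAlgebra V] T,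
        (LinearMap.range f).restrictScalars ℂ :=
  (EquivariantLift.iSup_range_eq_of_equiv
    (ΩEquivOne V c hGR hGR₀ hGR₁ hGR₂ hGR₃ η hη hηc h₁W A hV Φarch harm hdef χ ψ hψ)).symm

/-! ### § 3c. Slot 1 is UNTWISTED: `c_{V,1} = 1`, so `Ω₁(χ)` IS the dictionary carrier `Ω(splitLineOne, ψ)` -/

/-- **`c_{V,1} = 1`**: the slot-1 see-saw scalar has no `U(V)(𝔸_f)`-part (`eta₁ = cmEta₁ η ∘ snd`, `cmLineChar₁ = char₄ ∘ snd` —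
the `V`-dependence of `η` and the character `λ_V′` both sit in slot 0, tree `cmEta_torus` / `cmLineChar₀`). -/
theorem cVOne_apply_eq_one (g : ↥V.adelicFin) : cVOne V c hGR hGR₀ hGR₁ η g = 1 := by
  rw [cVOne_apply, finCharOne_apply, finPairDOne_apply, map_one, map_one]
  simp only [eta₁, cmLineChar₁, cmEta₁, MonoidHom.coe_comp, Function.comp_apply, MonoidHom.coe_snd, map_one, one_mul]
  exact map_one _

/-- `finCharOne (g, 1) = 1`. -/
theorem finCharOne_inl_eq_one (g : ↥V.adelicFin) : finCharOne V c.D hGR hGR₀ hGR₁ (eta₁ V c.D η) (g, 1) = 1 :=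
  cVOne_apply_eq_one V c hGR hGR₀ hGR₁ η g

/-- hence the UNTWISTED intertwining law of slot 1: `E (Ω(splitLineOne, ψ)(finFrameCongr g) x) = Ω₁(χ)(g) (E x)`. -/
theorem coinvEquivOne_weilCoinv (g : ↥V.adelicFin)
    (x : TwistedCoinv.Coinv (HodgeCM.WeilCoinv.finPairRepW _ _ _ _ _ _ _ _ _ _ _ _ _ _ _ _ _ (splitLineOne V c hGR₁).hs) ψ) :
    coinvEquivOne V c hGR hGR₀ hGR₁ hGR₂ hGR₃ η hη hηc h₁W A hV Φarch harm hdef χ ψ hψ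
        (((HodgeCM.WeilCoinv.weilCoinv _ _ _ _ _ _ _ _ _ _ _ _ _ _ _ _ _ ψ (splitLineOne V c hGR₁).hs).comp
          (finFrameCongr (L : Type) V.Hm (frameG V) (frameD V) (frame_congr V))) g x) =
      (thetaDistDatumOneOf V c hGR hGR₀ hGR₁ hGR₂ hGR₃ η hη hηc h₁W A hV Φarch harm hdef).coinvRep χ g
        (coinvEquivOne V c hGR hGR₀ hGR₁ hGR₂ hGR₃ η hη hηc h₁W A hV Φarch harm hdef χ ψ hψ x) := by
  rw [coinvRep_coinvEquivOne, finCharOne_inl_eq_one, Units.val_one, one_smul]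
  rfl

include hψ in
/-- **THE BRIDGE OF SLOT 1 LANDS IN THE DICTIONARY**: axioms-1's carrier `Ω(splitLineOne, ψ)` at `ιV := finFrameCongr` (#4 `SplitLine.Ω`)
IS the honest slot module `Ω₁(χ)`, as `ℂ[U(V)(𝔸_f)]`-modules, whenever `chiOne χ = finCharOne(1, ·) · ψ` (e.g. `ψ := psiOne χ`) — the
`adelicAlgebra V`-linear SURJECTION `Ω(line, ψ) ↠ Ω₁(χ)` the pinned junction's block socket asks for, as an isomorphism. -/
def dictEquivOne :
    (splitLineOne V c hGR₁).Ω (finFrameCongr (L : Type) V.Hm (frameG V) (frameD V) (frame_congr V)) ψ ≃ₗ[adelicAlgebra V]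
      ((thetaDistDatumOneOf V c hGR hGR₀ hGR₁ hGR₂ hGR₃ η hη hηc h₁W A hV Φarch harm hdef).coinvRep χ).asModule :=
  EquivariantLift.liftEquiv _ _ (coinvEquivOne V c hGR hGR₀ hGR₁ hGR₂ hGR₃ η hη hηc h₁W A hV Φarch harm hdef χ ψ hψ)
    (coinvEquivOne_weilCoinv V c hGR hGR₀ hGR₁ hGR₂ hGR₃ η hη hηc h₁W A hV Φarch harm hdef χ ψ hψ)

include hψ in
/-- **BLOCKS EQUAL (slot 1, dictionary currency)**: `⨆ f : Ω₁(χ) →ₗ T, (range f)|_ℂ = ⨆ f : Ω(splitLineOne, ψ) →ₗ T, (range f)|_ℂ`. -/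
theorem iSup_range_coinvRep_one_eq_dict {T : Type*} [AddCommMonoid T] [Module ℂ T] [Module (adelicAlgebra V) T]
    [IsScalarTower ℂ (adelicAlgebra V) T] :
    (⨆ f : ((thetaDistDatumOneOf V c hGR hGR₀ hGR₁ hGR₂ hGR₃ η hη hηc h₁W A hV Φarch harm hdef).coinvRep χ).asModule
        →ₗ[adelicAlgebra V] T, (LinearMap.range f).restrictScalars ℂ) =
      ⨆ f : (splitLineOne V c hGR₁).Ω (finFrameCongr (L : Type) V.Hm (frameG V) (frameD V) (frame_congr V)) ψ →ₗ[adelicAlgebra V] T,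
        (LinearMap.range f).restrictScalars ℂ :=
  (EquivariantLift.iSup_range_eq_of_equiv
    (dictEquivOne V c hGR hGR₀ hGR₁ hGR₂ hGR₃ η hη hηc h₁W A hV Φarch harm hdef χ ψ hψ)).symm

end One

end ThetaAdelicSide
end HodgeCM.Model

end
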